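import Summits.KontsevichZagierPeriods.KontsevichZagierPeriods.Theorems.RootDecompZetaThreeFrontierRungFourPreludeP12

/-! # `RootDecompZetaThreeFrontierRungFourPreludeP13` — part 13/14 of the mechanical ≤400-line split of `pre_src.lean` (sha256 ba362a5194d75c20…)
Source: decomp-kz lens-1 g12/g13 rung-4 prelude = Prelude_v3.lean @ba362a51 (Basis22_v1 sections RotFour/Shuffle/ProdFour/GenFb/WordMoves/RungFour/Basis22 + FacetGeneric_v2 §1–§23; critic CLEARED g6 row 330 / g6-20 l.1368); --supports stmt-KontsevichZagierPeriods-27141.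
Split by census-1 g10 `gen/splitlean.py`: scopes re-opened with their `open`/`variable`/`set_option` context; mathematics and declaration order unchanged. -/

set_option linter.dupNamespace false
open MeasureTheory Set
open Literature.NumberTheory.Transcendental
set_option linter.dupNamespace false
namespace Summit.KontsevichZagierPeriods.KontsevichZagierPeriods.Cruxes.GZNormalFormWThree.GZLadder.RungFour
open Summit.KontsevichZagierPeriods.KontsevichZagierPeriods.Cruxes.GZNormalFormWThree.GZLadder.FacetFour
  (not_integrableOn_of_residue)
section RunFacet
variable {M : ℕ}
set_option linter.unusedSimpArgs false

/-- POSITIVITY of the reduced forms on `baseR × [0, epsMax)` -/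
theorem redR_pos {a b : Fin (M + 1)} (hab : (a : ℕ) < b) (c : Chord (M + 1)) {x : Fin M → ℝ} (hx : x ∈ baseR a b)
    {ε : ℝ} (hε0 : 0 ≤ ε) (hε1 : ε < epsMax a b x) : 0 < redR a b c (x, ε) := by
  have hb := b.isLt
  have htop := topR_mem hab hx
  have htopeq := topR_eq hab x
  have hlow0 := lowB_nonneg hx
  have htl := tail_le_lowB hx
  have hs0 := slab_nonneg hx
  have hs1 := slab_le_one hx
  have hεtop : lowB b x < topR a x - ε := by unfold epsMax at hε1; linarith
  obtain ⟨hh, hhd, hs, hsi, htp, htd, hl⟩ := hx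
  obtain ⟨i, l, hil, proper⟩ := c
  have hil' : (i : ℕ) < l := hil
  have hl3 := l.isLt
  unfold redR
  simp only
  by_cases hc : (a : ℕ) + 1 ≤ i ∧ (l : ℕ) ≤ b + 1
  · -- cluster chord
    rw [if_pos hc]
    unfold slab
    by_cases hi1 : (i : ℕ) = a + 1
    · rw [if_pos hi1, sub_zero, if_neg (show ¬ ((l : ℕ) = a + 1) by omega)]
      by_cases hl1 : (l : ℕ) ≤ b
      · rw [dif_pos (show (l : ℕ) ≤ b ∧ (a : ℕ) + 1 < l from ⟨hl1, by omega⟩)]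
        exact (hs _ (by simp only [Fin.val_mk]; omega) (by simp only [Fin.val_mk]; omega)).1
      · rw [dif_neg (show ¬ ((l : ℕ) ≤ b ∧ (a : ℕ) + 1 < l) by omega)]; exact one_pos
    · rw [if_neg hi1, dif_pos (show (i : ℕ) ≤ b ∧ (a : ℕ) + 1 < i from ⟨by omega, by omega⟩),
        if_neg (show ¬ ((l : ℕ) = a + 1) by omega)]
      by_cases hl1 : (l : ℕ) ≤ b
      · rw [dif_pos (show (l : ℕ) ≤ b ∧ (a : ℕ) + 1 < l from ⟨hl1, by omega⟩)]
        exact sub_pos.2 (hsi ⟨(i : ℕ) - 1, by omega⟩ ⟨(l : ℕ) - 1, by omega⟩ (by simp only [Fin.val_mk]; omega)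
          (Fin.mk_lt_mk.2 (by omega)) (by simp only [Fin.val_mk]; omega))
      · rw [dif_neg (show ¬ ((l : ℕ) ≤ b ∧ (a : ℕ) + 1 < l) by omega)]
        linarith [(hs ⟨(i : ℕ) - 1, by omega⟩ (by simp only [Fin.val_mk]; omega) (by simp only [Fin.val_mk]; omega)).2]
  · -- non-cluster chord
    rw [if_neg hc]
    simp only [Chord.form, xpt_mapR_insR hab]
    by_cases hia : (i : ℕ) ≤ a
    · -- `i` is a head label (or `0`): its point is `> topR`
      have hbig : topR a x < (if h0 : (i : ℕ) = 0 then (1:ℝ) else if h1 : (i : ℕ) ≤ a + 1 then x ⟨(i : ℕ) - 1, by omega⟩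
          else if h2 : (i : ℕ) ≤ b then topR a x - ε * x ⟨(i : ℕ) - 1, by omega⟩
          else if h3 : (i : ℕ) = b + 1 then topR a x - ε
          else if h4 : (i : ℕ) ≤ M + 1 then x ⟨(i : ℕ) - 2, by omega⟩ else 0) := by
        by_cases hi0 : (i : ℕ) = 0
        · rw [dif_pos hi0]; exact htop.2
        · rw [dif_neg hi0, dif_pos (by omega), htopeq]
          exact hhd ⟨(i : ℕ) - 1, by omega⟩ ⟨a, by omega⟩ (Fin.mk_lt_mk.2 (by omega)) (by simp)
      by_cases hi0 : (i : ℕ) = 0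
      · rw [dif_pos hi0] at hbig ⊢
        rw [dif_neg (show ¬ ((l : ℕ) = 0) by omega)]
        by_cases hl1 : (l : ℕ) ≤ a + 1
        · rw [dif_pos hl1]; linarith [(hh ⟨(l : ℕ) - 1, by omega⟩ (by simp only [Fin.val_mk]; omega)).2]
        rw [dif_neg hl1]
        by_cases hl2 : (l : ℕ) ≤ b
        · rw [dif_pos hl2]
          have := hs ⟨(l : ℕ) - 1, by omega⟩ (by simp only [Fin.val_mk]; omega) (by simp only [Fin.val_mk]; omega)
          nlinarith [this.1]
        rw [dif_neg hl2]
        by_cases hl4 : (l : ℕ) = b + 1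
        · rw [dif_pos hl4]; linarith
        rw [dif_neg hl4]
        by_cases hl5 : (l : ℕ) ≤ M + 1
        · rw [dif_pos hl5]; linarith [htl ⟨(l : ℕ) - 2, by omega⟩ (by simp only [Fin.val_mk]; omega)]
        · rw [dif_neg hl5]; norm_num
      rw [dif_neg hi0, dif_pos (show (i : ℕ) ≤ a + 1 by omega)] at hbig ⊢
      rw [dif_neg (show ¬ ((l : ℕ) = 0) by omega)]
      have hxi := hh ⟨(i : ℕ) - 1, by omega⟩ (by simp only [Fin.val_mk]; omega)
      by_cases hl1 : (l : ℕ) ≤ a + 1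
      · rw [dif_pos hl1]
        exact sub_pos.2 (hhd ⟨(i : ℕ) - 1, by omega⟩ ⟨(l : ℕ) - 1, by omega⟩ (Fin.mk_lt_mk.2 (by omega))
          (by simp only [Fin.val_mk]; omega))
      rw [dif_neg hl1]
      by_cases hl2 : (l : ℕ) ≤ b
      · rw [dif_pos hl2]
        have := hs ⟨(l : ℕ) - 1, by omega⟩ (by simp only [Fin.val_mk]; omega) (by simp only [Fin.val_mk]; omega)
        nlinarith [this.1]
      rw [dif_neg hl2]
      by_cases hl4 : (l : ℕ) = b + 1
      · rw [dif_pos hl4]; linarith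
      rw [dif_neg hl4]
      by_cases hl5 : (l : ℕ) ≤ M + 1
      · rw [dif_pos hl5]; linarith [htl ⟨(l : ℕ) - 2, by omega⟩ (by simp only [Fin.val_mk]; omega)]
      · rw [dif_neg hl5]; linarith [hxi.1]
    · -- `i` is a run or tail label and `l ≥ b + 2`
      have hlb : (b : ℕ) + 2 ≤ l := by
        by_contra hcon
        exact hc ⟨by omega, by omega⟩
      rw [dif_neg (show ¬ ((i : ℕ) = 0) by omega)]
      -- the `l` point is `≤ lowB`
      have hsmall : (if h0 : (l : ℕ) = 0 then (1:ℝ) else if h1 : (l : ℕ) ≤ a + 1 then x ⟨(l : ℕ) - 1, by omega⟩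
          else if h2 : (l : ℕ) ≤ b then topR a x - ε * x ⟨(l : ℕ) - 1, by omega⟩
          else if h3 : (l : ℕ) = b + 1 then topR a x - ε
          else if h4 : (l : ℕ) ≤ M + 1 then x ⟨(l : ℕ) - 2, by omega⟩ else 0) ≤ lowB b x := by
        rw [dif_neg (by omega), dif_neg (by omega), dif_neg (by omega), dif_neg (by omega)]
        by_cases hl5 : (l : ℕ) ≤ M + 1
        · rw [dif_pos hl5]; exact htl _ (by simp only [Fin.val_mk]; omega)
        · rw [dif_neg hl5]; exact hlow0
      by_cases hi1 : (i : ℕ) ≤ a + 1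
      · -- `i = a + 1`, the top of the run
        rw [dif_pos hi1]
        have : x ⟨(i : ℕ) - 1, by omega⟩ = topR a x := by
          rw [htopeq]; exact congrArg x (Fin.ext (by simp only [Fin.val_mk]; omega))
        rw [this]; linarith
      rw [dif_neg hi1]
      by_cases hi2 : (i : ℕ) ≤ b
      · rw [dif_pos hi2]
        have hxi := hs ⟨(i : ℕ) - 1, by omega⟩ (by simp only [Fin.val_mk]; omega) (by simp only [Fin.val_mk]; omega)
        have : ε * x ⟨(i : ℕ) - 1, by omega⟩ ≤ ε := by nlinarith [hxi.2]
        linarith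
      rw [dif_neg hi2]
      by_cases hi3 : (i : ℕ) = b + 1
      · rw [dif_pos hi3]; linarith
      rw [dif_neg hi3, dif_pos (show (i : ℕ) ≤ M + 1 by omega)]
      -- both in the tail
      rw [dif_neg (show ¬ ((l : ℕ) = 0) by omega), dif_neg (show ¬ ((l : ℕ) ≤ a + 1) by omega),
        dif_neg (show ¬ ((l : ℕ) ≤ b) by omega), dif_neg (show ¬ ((l : ℕ) = b + 1) by omega)]
      by_cases hl5 : (l : ℕ) ≤ M + 1
      · rw [dif_pos hl5]
        exact sub_pos.2 (htd ⟨(i : ℕ) - 2, by omega⟩ ⟨(l : ℕ) - 2, by omega⟩ (by simp only [Fin.val_mk]; omega)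
          (Fin.mk_lt_mk.2 (by omega)))
      · rw [dif_neg hl5, sub_zero]; exact htp _ (by simp only [Fin.val_mk]; omega)

/-- number of cluster chords -/
noncomputable def nR (a b : Fin (M + 1)) (S : Fin (M + 1) → Chord (M + 1)) : ℕ :=
  (Finset.univ.filter fun m => (a : ℕ) + 1 ≤ (S m).i ∧ ((S m).j : ℕ) ≤ b + 1).card

/-- Auxiliary step `prod_form_mapR_insR`: prod form map R ins R. [bookkeeping] -/
theorem prod_form_mapR_insR {a b : Fin (M + 1)} (hab : (a : ℕ) < b) (S : Fin (M + 1) → Chord (M + 1)) {E : ℕ}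
    (hS : nR a b S ≤ E) (x : Fin M → ℝ) {t : ℝ} (ht : t ≠ 0) :
    (∏ m, 1 / (S m).form (mapR a b (Fin.insertNth b t x))) * t ^ E =
      t ^ (E - nR a b S) * ∏ m, 1 / redR a b (S m) (x, t) := by
  classical
  simp only [form_mapR_insR hab]
  rw [show (fun m => 1 / ((if (a : ℕ) + 1 ≤ (S m).i ∧ ((S m).j : ℕ) ≤ b + 1 then t else 1) * redR a b (S m) (x, t))) =
      fun m => (1 / (if (a : ℕ) + 1 ≤ (S m).i ∧ ((S m).j : ℕ) ≤ b + 1 then t else 1)) * (1 / redR a b (S m) (x, t)) from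
      funext fun m => by rw [one_div_mul_one_div], Finset.prod_mul_distrib]
  have h1 : (∏ m, 1 / (if (a : ℕ) + 1 ≤ (S m).i ∧ ((S m).j : ℕ) ≤ b + 1 then t else (1:ℝ))) = 1 / t ^ nR a b S := by
    rw [Finset.prod_div_distrib, Finset.prod_const_one]
    congr 1
    rw [← Finset.prod_filter, Finset.prod_const]
    rfl
  rw [h1]
  have h3 : t ^ E = t ^ nR a b S * t ^ (E - nR a b S) := by rw [← pow_add, Nat.add_sub_cancel' hS]
  rw [h3]
  field_simp

/-- Auxiliary definition `gTermR`: g Term R. [bookkeeping] -/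
noncomputable def gTermR (a b : Fin (M + 1)) (S : Fin (M + 1) → Chord (M + 1)) (z : (Fin M → ℝ) × ℝ) : ℝ :=
  z.2 ^ (runInt a b + 1 - nR a b S) * ∏ m, 1 / redR a b (S m) z

open Classical in
/-- the RESIDUE along the run facet `{t_a, …, t_b}` -/
noncomputable def resR (a b : Fin (M + 1)) (F : Finset (Fin (M + 1) → Chord (M + 1)))
    (q : (Fin (M + 1) → Chord (M + 1)) → ℚ) (x : Fin M → ℝ) : ℝ :=
  ∑ S ∈ F, if nR a b S = runInt a b + 1 then (q S : ℝ) * ∏ m, 1 / redR a b (S m) (x, 0) else 0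

open Classical in
/-- Auxiliary step `gTermR_zero`: g Term R zero. [bookkeeping] -/
theorem gTermR_zero (a b : Fin (M + 1)) (S : Fin (M + 1) → Chord (M + 1)) (hS : nR a b S ≤ runInt a b + 1)
    (x : Fin M → ℝ) (q : ℚ) :
    (q : ℝ) * gTermR a b S (x, 0) =
      if nR a b S = runInt a b + 1 then (q : ℝ) * ∏ m, 1 / redR a b (S m) (x, 0) else 0 := by
  unfold gTermR
  by_cases h : nR a b S = runInt a b + 1
  · rw [if_pos h, h]; simp
  · rw [if_neg h, zero_pow (by omega)]; simp

/-- Auxiliary step `continuous_mapR`: continuous map R. [bookkeeping] -/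
theorem continuous_mapR (a b : Fin (M + 1)) : Continuous (mapR (M := M) a b) := by
  refine continuous_pi fun i => ?_
  simp only [mapR, psiR, sigR]
  split_ifs <;> fun_prop

/-- Auxiliary step `continuous_slab`: continuous slab. [bookkeeping] -/
theorem continuous_slab (a b : Fin (M + 1)) (l : Fin (M + 3)) : Continuous fun x : Fin M → ℝ => slab a b x l := by
  unfold slab; split_ifs <;> fun_prop

/-- Auxiliary step `continuous_redR`: continuous red R. [bookkeeping] -/
theorem continuous_redR (a b : Fin (M + 1)) (c : Chord (M + 1)) : Continuous (redR a b c) := by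
  unfold redR
  split_ifs
  · exact ((continuous_slab a b _).comp continuous_fst).sub ((continuous_slab a b _).comp continuous_fst)
  · exact (continuous_form c).comp ((continuous_mapR a b).comp (continuous_insertNth_pair' b))

/-- Auxiliary step `continuousOn_gTermR`: continuous On g Term R. [bookkeeping] -/
theorem continuousOn_gTermR {a b : Fin (M + 1)} (hab : (a : ℕ) < b) (S : Fin (M + 1) → Chord (M + 1))
    {K : Set (Fin M → ℝ)} (hK : K ⊆ baseR a b) {η₀ : ℝ} (hη : ∀ x ∈ K, η₀ < epsMax a b x) :
    ContinuousOn (gTermR a b S) (K ×ˢ Icc 0 η₀) := by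
  unfold gTermR
  refine ContinuousOn.mul (by fun_prop) (continuousOn_finsetProd _ fun m _ => ?_)
  refine ContinuousOn.div continuousOn_const (continuous_redR a b (S m)).continuousOn fun z hz => ?_
  obtain ⟨hz1, hz2⟩ := hz
  exact (redR_pos hab (S m) (hK hz1) hz2.1 (lt_of_le_of_lt hz2.2 (hη z.1 hz1))).ne'

/-- (F-run, generic `k = M+1`, `a < b`): pulled back through `R_{a,b}` (Jacobian `ε ^ runInt a b`), an integrable
frame-monomial combination with at most `runInt a b + 1` cluster chords per family (true for frames) has
vanishing residue along `ε → 0` on `baseR a b`. -/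
theorem resR_eq_zero {a b : Fin (M + 1)} (hab : a < b) (F : Finset (Fin (M + 1) → Chord (M + 1)))
    (q : (Fin (M + 1) → Chord (M + 1)) → ℚ) (hclus : ∀ S ∈ F, nR a b S ≤ runInt a b + 1)
    (hint : IntegrableOn (fun p : Fin (M + 1) → ℝ =>
      (∑ S ∈ F, (q S : ℝ) * ∏ m, 1 / (S m).form (mapR a b p)) * p b ^ runInt a b) (domR a b)) :
    ∀ x ∈ baseR a b, resR a b F q x = 0 := by
  classical
  have hab' : (a : ℕ) < b := hab
  set G : (Fin M → ℝ) × ℝ → ℝ := fun z => ∑ S ∈ F, (q S : ℝ) * gTermR a b S z with hGdef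
  have hG0 : ∀ x, G (x, 0) = resR a b F q x := fun x => by
    simp only [hGdef, resR]
    exact Finset.sum_congr rfl fun S hS => gTermR_zero a b S (hclus S hS) x (q S)
  by_contra hcon
  push Not at hcon
  obtain ⟨x₁, hx₁, hR⟩ := hcon
  set e₁ := epsMax a b x₁ with he₁
  have he0 : 0 < e₁ := epsMax_pos hx₁
  have he1 : e₁ < 1 := epsMax_lt_one hab' hx₁
  set U : Set (Fin M → ℝ) := baseR a b ∩ {x | e₁ / 2 < epsMax a b x} with hU
  have hUopen : IsOpen U := (isOpen_baseR a b).inter (isOpen_lt continuous_const (continuous_epsMax a b))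
  have hx₁U : x₁ ∈ U := ⟨hx₁, by show e₁ / 2 < epsMax a b x₁; rw [← he₁]; linarith⟩
  have hcontU : ContinuousOn (fun x => G (x, 0)) U := by
    have h1 : ContinuousOn G (U ×ˢ Icc 0 (e₁ / 2)) := by
      refine continuousOn_finsetSum _ fun S hS => ContinuousOn.mul continuousOn_const ?_
      exact continuousOn_gTermR hab' S (fun x hx => hx.1) (fun x hx => hx.2)
    refine h1.comp (Continuous.continuousOn (by fun_prop)) fun x hx => ⟨hx, ⟨le_rfl, by linarith⟩⟩
  have hcontAt : ContinuousAt (fun x => G (x, 0)) x₁ := hcontU.continuousAt (hUopen.mem_nhds hx₁U)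
  have hne₁ : G (x₁, 0) ≠ 0 := by rw [hG0]; exact hR
  have hev : ∀ᶠ y in nhds x₁, G (y, 0) ≠ 0 := hcontAt.eventually_ne hne₁
  obtain ⟨ρ₁, hρ₁, hball₁⟩ := Metric.eventually_nhds_iff_ball.1 hev
  obtain ⟨ρ₂, hρ₂, hball₂⟩ := Metric.isOpen_iff.1 hUopen x₁ hx₁U
  set ρ := min ρ₁ ρ₂ / 2 with hρ
  have hρpos : 0 < ρ := by positivity
  set K := Metric.closedBall x₁ ρ with hK
  have hKU : K ⊆ U := fun y hy => hball₂ (Metric.mem_ball.2 (lt_of_le_of_lt (Metric.mem_closedBall.1 hy)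
    (by rw [hρ]; linarith [min_le_right ρ₁ ρ₂])))
  have hKne0 : ∀ y ∈ K, G (y, 0) ≠ 0 := fun y hy => hball₁ y (Metric.mem_ball.2
    (lt_of_le_of_lt (Metric.mem_closedBall.1 hy) (by rw [hρ]; linarith [min_le_left ρ₁ ρ₂])))
  refine not_integrableOn_of_residue b (isOpen_domR a b).measurableSet _ K
    (isCompact_closedBall x₁ ρ) (Metric.measure_closedBall_pos volume x₁ hρpos).ne' (η₀ := e₁ / 2)
    (by positivity) (by linarith) (fun x hx t ht => ?_) G ?_ (fun x hx t ht => ?_) hKne0 hint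
  · have hxU := hKU hx
    exact insR_mem_domR hab hxU.1 ht.1 (lt_trans ht.2 hxU.2)
  · refine continuousOn_finsetSum _ fun S hS => ContinuousOn.mul continuousOn_const ?_
    exact continuousOn_gTermR hab' S (fun x hx => (hKU hx).1) (fun x hx => (hKU hx).2)
  · simp only [hGdef, gTermR, insT_self]
    rw [Finset.sum_mul, Finset.sum_mul]
    refine Finset.sum_congr rfl fun S hS => ?_
    have := prod_form_mapR_insR hab' S (hclus S hS) x (t := t) ht.1.ne'
    calc (q S : ℝ) * (∏ m, 1 / (S m).form (mapR a b (Fin.insertNth b t x))) * t ^ runInt a b * t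
        = (q S : ℝ) * ((∏ m, 1 / (S m).form (mapR a b (Fin.insertNth b t x))) * t ^ (runInt a b + 1)) := by ring
      _ = (q S : ℝ) * (t ^ (runInt a b + 1 - nR a b S) * ∏ m, 1 / redR a b (S m) (x, t)) := by rw [this]

/-- CLUSTER BOUND for frames: cluster gap vectors live on the `b − a` gaps `a+1 ≤ l ≤ b` -/
theorem IsFrame.nR_le {S : Fin (M + 1) → Chord (M + 1)} (hS : IsFrame S) {a b : Fin (M + 1)} (hab : a < b) :
    nR a b S ≤ runInt a b + 1 := by
  classical
  have hab' : (a : ℕ) < b := hab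
  have hb := b.isLt
  set T : Finset (Fin (M + 2)) := Finset.univ.filter fun l => (a : ℕ) + 1 ≤ l ∧ (l : ℕ) ≤ b with hT
  have hcard : T.card = runInt a b + 1 := by
    rw [runInt_eq]
    have e : T = Finset.Icc (⟨(a : ℕ) + 1, by omega⟩ : Fin (M + 2)) ⟨(b : ℕ), by omega⟩ := by
      ext l
      simp only [hT, Finset.mem_filter, Finset.mem_univ, true_and, Finset.mem_Icc, Fin.le_def, Fin.val_mk]
    rw [e, Fin.card_Icc]
    simp
    omega
  rw [← hcard]
  refine hS.card_filter_le (fun c => (a : ℕ) + 1 ≤ c.i ∧ (c.j : ℕ) ≤ b + 1) T fun c hc l hl => ?_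
  unfold Chord.vec
  rw [if_neg]
  rintro ⟨h1, h2⟩
  apply hl
  simp only [hT, Finset.mem_filter, Finset.mem_univ, true_and]
  exact ⟨hc.1.trans h1, by omega⟩

/-- **(F-run) PACKAGED, generic `k = M+1`, any run `a < b`**: an integrable frame combination on `Δ_{M+1}` has
vanishing residue along the facet `{t_a, …, t_b}`. -/
theorem facet_run {a b : Fin (M + 1)} (hab : a < b) (F : Finset (Fin (M + 1) → Chord (M + 1)))
    (q : (Fin (M + 1) → Chord (M + 1)) → ℚ) (hF : ∀ S ∈ F, IsFrame S)
    (hint : IntegrableOn (fun t : Fin (M + 1) → ℝ => ∑ S ∈ F, (q S : ℝ) * ∏ m, 1 / (S m).form t)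
      (KZ.openOrderedSimplex (M + 1))) :
    ∀ x ∈ baseR a b, resR a b F q x = 0 :=
  resR_eq_zero hab F q (fun S hS => (hF S hS).nR_le hab) ((integrableOn_pullR_iff hab _).1 hint)

/-- **ALL FACETS, every `k = M+1`** (frames + `L¹(Δ_{M+1})`): every tail facet `{t_j,…,t_M,0}`, every reflected tail
facet `{1,t_0,…}`, and every run facet `{t_a,…,t_b}` (the gap facets are the runs `b = a+1`) has identically
vanishing residue. -/
theorem facets_all (F : Finset (Fin (M + 1) → Chord (M + 1))) (q : (Fin (M + 1) → Chord (M + 1)) → ℚ)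
    (hF : ∀ S ∈ F, IsFrame S)
    (hint : IntegrableOn (fun t : Fin (M + 1) → ℝ => ∑ S ∈ F, (q S : ℝ) * ∏ m, 1 / (S m).form t)
      (KZ.openOrderedSimplex (M + 1))) :
    (∀ j : Fin (M + 1), ∀ x ∈ baseT j, resT j F q x = 0) ∧
    (∀ j : Fin (M + 1), ∀ x ∈ baseT j, resT j (F.map ⟨reflFam, reflFam_injective⟩) (fun S' => q (reflFam S')) x = 0) ∧
    (∀ a b : Fin (M + 1), a < b → ∀ x ∈ baseR a b, resR a b F q x = 0) :=
  ⟨fun j => facet_tail j F q hF hint, fun j => facet_tail_refl j F q hF hint, fun _ _ hab => facet_run hab F q hF hint⟩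

end RunFacet

/-! ## §21 GLUE (R3-a): from a cellular generator (`KZ.IntegralRep` on `Δ_{M+1}` with logarithmic integrand — Rung4_v2
`cellGens`, `IsLogOn`; `simplex k = KZ.openOrderedSimplex k` by `rfl`) to the data `(F, q, hF, hint)` of `facets_all`:
the integrability is the `integrableOn` field of the representation. -/

section Glue
variable {M : ℕ}

/-- **(F_k) for cellular generators**: the integrand of an integral representation on `Δ_{M+1}` with logarithmic
integrand is a frame combination `Σ_S q_S ∏ 1/(S m).form` which is integrable on `Δ_{M+1}`, hence has ALL facet
residues identically zero (`facets_all`). -/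
theorem facets_of_rep (s : KZ.IntegralRep (M + 1)) (hdom : s.domain = KZ.openOrderedSimplex (M + 1))
    (hlog : IsLogOn (M + 1) s.integrand s.domain) :
    ∃ (F : Finset (Fin (M + 1) → Chord (M + 1))) (q : (Fin (M + 1) → Chord (M + 1)) → ℚ),
      (∀ S ∈ F, IsFrame S) ∧
      EqOn s.integrand (fun t => ∑ S ∈ F, (q S : ℝ) * ∏ m, 1 / (S m).form t) (KZ.openOrderedSimplex (M + 1)) ∧
      IntegrableOn (fun t : Fin (M + 1) → ℝ => ∑ S ∈ F, (q S : ℝ) * ∏ m, 1 / (S m).form t)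
        (KZ.openOrderedSimplex (M + 1)) ∧
      (∀ j : Fin (M + 1), ∀ x ∈ baseT j, resT j F q x = 0) ∧
      (∀ j : Fin (M + 1), ∀ x ∈ baseT j,
        resT j (F.map ⟨reflFam, reflFam_injective⟩) (fun S' => q (reflFam S')) x = 0) ∧
      (∀ a b : Fin (M + 1), a < b → ∀ x ∈ baseR a b, resR a b F q x = 0) := by
  obtain ⟨F, q, hF, hEq⟩ := hlog
  rw [hdom] at hEq
  have hint0 : IntegrableOn s.integrand (KZ.openOrderedSimplex (M + 1)) := hdom ▸ s.integrableOn
  have hint : IntegrableOn (fun t : Fin (M + 1) → ℝ => ∑ S ∈ F, (q S : ℝ) * ∏ m, 1 / (S m).form t)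
      (KZ.openOrderedSimplex (M + 1)) :=
    (integrableOn_congr_fun hEq (KZ.measurableSet_openOrderedSimplex (M + 1))).1 hint0
  exact ⟨F, q, hF, hEq, hint, facets_all F q hF hint⟩

end Glue

/-! ## §22 (R1 INTERFACE) the residue functions at `ε = 0`, EXPLICITLY: on the tail facet the tail points collapse
to `0`, on a run facet the run points collapse to `topR a x`; the residue monomials are products of reciprocals of the
explicit values below (cluster chords: differences of the shape labels `ylabT` / `slab`). -/

section Evaluate
variable {M : ℕ}
set_option linter.unusedSimpArgs false

/-- the collapsed points on the tail facet `t_j = … = t_M = 0` -/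
def ptT0 (j : Fin (M + 1)) (x : Fin M → ℝ) (l : Fin (M + 3)) : ℝ :=
  if h0 : (l : ℕ) = 0 then 1 else if h : (l : ℕ) ≤ j then x ⟨(l : ℕ) - 1, by omega⟩ else 0

end Evaluate
end Summit.KontsevichZagierPeriods.KontsevichZagierPeriods.Cruxes.GZNormalFormWThree.GZLadder.RungFour
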